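import Mathlib
import Summits.Ventures.PercRepro.TriangleCapUpperZoneArith
import Summits.Ventures.PercRepro.TriangleCapStarFamilyNecessityUpper
import Summits.Ventures.PercRepro.TriangleCapZoneTwo

/-!
# PercRepro — THE UPPER REGIME ONE BELOW ITS THRESHOLD: EXACTLY `ρ` INSIDE EDGES (p3, gen 57; part 336)

`D + 1 ≤ 2 r`, `ρ = D − r ≥ 2`, `X = D − 2 ρ`, `m = D + r − 3`, `t = m D + r`, `I = ρ`: the columns sum to
`t + ρ = (m + 1) D`, the rows to `t − ρ = m D + X`.  A partial column costs `2 (D − 1)` (`column_loss_zero`, part 331);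
otherwise every column is empty or full, an inside edge `x x'` has `c(x) = c(x') = D` and
`inDeg x + inDeg x' ≤ ρ + 1`, so its disjoint rows number `≥ 2 D − ρ − 1 = m + 2` and the row cost is
`≥ φ_D(X) + 2 (X − 1)` (`≥ 3 (D − 1)` when `X = 1`) by part 334.  Hence
`t (t − 1) + 2 ρ (X + 1) + (2 X − 2) ≤ 2 j + 2 t (D − 1)` for every `X ≥ 1`, and
`t (t − 1) + 4 (D − 1) ≤ 2 j + 2 t (D − 1)` in the tight regime `X = 1` (`upper_zone_I_eq`).  Axioms: standard.
-/

namespace PercRepro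

namespace TriangleCap

namespace C047

open Finset

variable {V : Type*} [Fintype V] [DecidableEq V]

/-- `2 ρ (X + 1) + (2 X − 2) = 2 ρ + (X (D − X) + 2 (X − 1))` with `ρ = D − r`, `X = 2 r − D`. -/
theorem at_arith (D r : ℕ) (h1 : D + 1 ≤ 2 * r) (h2 : r + 2 ≤ D) :
    2 * ((D - r) * (D - 2 * (D - r) + 1)) + (2 * (D - 2 * (D - r)) - 2) =
      2 * (D - r) + ((2 * r - D) * (D - (2 * r - D)) + 2 * (2 * r - D - 1)) := by
  obtain ⟨ρ, rfl⟩ : ∃ ρ, D = r + ρ := ⟨D - r, by omega⟩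
  obtain ⟨X, rfl⟩ : ∃ X, r = ρ + X + 1 := ⟨r - ρ - 1, by omega⟩
  have e1 : ρ + X + 1 + ρ - (ρ + X + 1) = ρ := by omega
  have e2 : ρ + X + 1 + ρ - 2 * ρ + 1 = X + 2 := by omega
  have e3 : ρ + X + 1 + ρ - 2 * ρ = X + 1 := by omega
  have e4 : 2 * (X + 1) - 2 = 2 * X := by omega
  have e5 : 2 * (ρ + X + 1) - (ρ + X + 1 + ρ) = X + 1 := by omega
  have e6 : ρ + X + 1 + ρ - (X + 1) = 2 * ρ := by omega
  have e7 : X + 1 - 1 = X := by omega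
  rw [e1, e2, e3, e4, e5, e6, e7]
  ring

/-- **EXACTLY `ρ` INSIDE EDGES:** for `D + 1 ≤ 2 r`, `r + 2 ≤ D`, `m + 3 = D + r`, `t = m D + r`, every triangle-free
`H` with `s` edges, `w` of degree `s − t ≥ 1`, every off-degree `≤ D`, at the band value `2 j` with `I = D − r`
inside edges has `t (t − 1) + 2 ρ (D − 2 ρ + 1) + (2 (D − 2 ρ) − 2) ≤ 2 j + 2 t (D − 1)`, and
`t (t − 1) + 4 (D − 1) ≤ 2 j + 2 t (D − 1)` when `D + 1 = 2 r`. -/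
theorem upper_zone_I_eq (H : SimpleGraph V) [DecidableRel H.Adj] (hfree : H.CliqueFree 3) (s m r D j : ℕ)
    (h1 : D + 1 ≤ 2 * r) (h2 : r + 2 ≤ D) (hm : m + 3 = D + r) (hs : H.edgeFinset.card = s) (w : V)
    (hw : deg H w + (m * D + r) = s) (hw1 : 1 ≤ deg H w)
    (hj : ∑ v, deg H v * deg H v + 2 * ((m * D + r) * (s - (m * D + r) - 1)) + 2 * j = s * (s + 1))
    (hD : ∀ v, offDeg H w v ≤ D) (hI : (insideEdges H w).card = D - r) :
    ((m * D + r) * (m * D + r - 1) + 2 * ((D - r) * (D - 2 * (D - r) + 1)) + (2 * (D - 2 * (D - r)) - 2) ≤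
        2 * j + 2 * ((m * D + r) * (D - 1))) ∧
      (D + 1 = 2 * r → (m * D + r) * (m * D + r - 1) + 4 * (D - 1) ≤ 2 * j + 2 * ((m * D + r) * (D - 1))) := by
  set t := m * D + r with ht
  have hD0 : 0 < D := by omega
  have hD3 : 3 ≤ D := by omega
  have hdef := deficiency_identity_split H hfree s t j D hs w hw hw1 hj hD
  have hoff : (offEdges H w).card = t := by
    have := card_offEdges_add_deg H w
    omega
  have hatt := attach_add_card_inside H hfree w
  rw [hoff] at hatt
  have hsumcol := sum_offDeg_nonNbrs_eq_add_card_inside H hfree w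
  rw [hoff] at hsumcol
  have hsumrow : ∑ y ∈ univ.filter (fun y => H.Adj w y), offDeg H w y = t - (insideEdges H w).card := by
    unfold attach at hatt
    omega
  rw [hI] at hdef hsumcol hsumrow
  have hrow := sum_mul_sub_ge_phi (univ.filter (fun y => H.Adj w y)) (offDeg H w) D (fun y _ => hD y)
  rw [hsumrow] at hrow
  have eminus : t - (D - r) = D * m + (2 * r - D) := by rw [ht, Nat.mul_comm D m]; omega
  rw [eminus, phiD_mul_add, phiD_of_lt D (2 * r - D) (by omega)] at hrow
  have hmodcol : (∑ z ∈ nonNbrs H w, offDeg H w z) % D = 0 := by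
    have e : t + (D - r) = D * (m + 1) := by
      have : D * (m + 1) = m * D + D := by ring
      omega
    rw [hsumcol, e, Nat.mul_mod_right]
  have harith := at_arith D r h1 h2
  have hY1 : 1 ≤ 2 * r - D := by omega
  -- a partial column, or every column empty or full
  by_cases hP : ∃ z ∈ nonNbrs H w, 1 ≤ offDeg H w z ∧ offDeg H w z + 1 ≤ D
  · obtain ⟨z, hz, hz1, hzD⟩ := hP
    have hloss := column_loss_zero (nonNbrs H w) (offDeg H w) D (by omega) (fun x _ => hD x) z hz hz1 hzD hmodcol
    constructor
    · omega
    · intro htight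
      have hX : 2 * r - D = 1 := by omega
      rw [hX, one_mul] at hrow
      omega
  · have hcols : ∀ x ∈ nonNbrs H w, offDeg H w x = 0 ∨ offDeg H w x = D := by
      intro x hx
      have := hD x
      by_contra hne
      rw [not_or] at hne
      exact hP ⟨x, hx, by omega, by omega⟩
    -- the inside edge: both columns full, hence `m + 2` active rows
    obtain ⟨x, hx, x', hx', hxx'⟩ := exists_adj_nonNbrs H w (by omega)
    have hnb := nbrDeg_add_nbrDeg_le_active H hfree w x x' hx hx' hxx'
    have hin := inDeg_add_inDeg_le_inside_succ H w x x' hx hx' hxx'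
    rw [hI] at hin
    have hcx := offDeg_eq_nbrDeg_add_inDeg H w x hx
    have hcx' := offDeg_eq_nbrDeg_add_inDeg H w x' hx'
    have hin1 : 1 ≤ inDeg H w x := by
      unfold inDeg
      exact card_pos.mpr ⟨x', mem_filter.mpr ⟨hx', hxx'⟩⟩
    have hin1' : 1 ≤ inDeg H w x' := by
      unfold inDeg
      exact card_pos.mpr ⟨x, mem_filter.mpr ⟨hx, H.adj_symm hxx'⟩⟩
    have hxD := hcols x hx
    have hx'D := hcols x' hx'
    have hact : m + 2 ≤ ((univ.filter (fun y => H.Adj w y)).filter (fun y => 1 ≤ offDeg H w y)).card := by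
      rw [filter_filter]
      omega
    have hrows := rows_ge_of_active (univ.filter (fun y => H.Adj w y)) (offDeg H w) D m (2 * r - D) hD3
      (fun y _ => hD y) hY1 (by omega) (by rw [hsumrow, eminus, Nat.mul_comm]) hact
    rw [phiD_of_lt D (2 * r - D) (by omega)] at hrows
    obtain ⟨hrows1, hrows2⟩ := hrows
    constructor
    · omega
    · intro htight
      have hX : 2 * r - D = 1 := by omega
      have := hrows2 hX
      rw [hX, one_mul] at hrow
      omega

end C047

end TriangleCap

end PercRepro
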